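import Summits.QuantumFields.BalabanUV.Beta.GAN24.CombChargeRowsHold
import Summits.QuantumFields.BalabanUV.Beta.FixedPointIdentification
import Summits.QuantumFields.BalabanUV.Beta.D1BFx.RoadEnd

/-!
# `BalabanUV.Beta.GAN24.CombTowerEndRowD1Sockets` — binder row G-an2-4 ∕ (CONV-C), TRANSFER-III: **THE (III′) END OF RECORD PLUGGED INTO EVERY CONSUMER
# SOCKET, HYPOTHESIS-FREE** — the comb-chart twin of the (E) pair `RowD1LiteralOfTowerEnd` §2 (leaf-01 g78) + `TowerEndRowD1Sockets` (OWNER gen 45), now for row D1's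
# literal of record `JsB12CombShSym hLc N (symTablesAn1S2 3 Lc cΛ) cΛ cB` at an1's sym tables, with NO letter row, NO contact letter, NO slot hypothesis left:
# the END `CombChargeRowsHold` (OWNER gen 55, p609000 ✓) read in the currencies of lane asym1 (`GeomRate` = `LimitForm.conv`), road A2 (convergence form),
# road «FP» (rate binder `hrate`), road «BF-x» (mean grading) and the END grade (`EndpointExistence`), each BY NAME.
# (OWNER `b2b-balaban-gan24-p1`, gen 56; journal [GAN24P1-G56-INTENT-1]; `bears_on: R4-G`)

HONEST DEPENDENCY (page 1, mandatory): continuum YM on T⁴ ⇐ BetaPertH ∧ nine spine estimates (0/9 proved); BetaPertH ⇐ (D1) ∧ (D4) ∧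
CAP+tail; G-an2-4 gates asym, D1 and NE2/3/4.  HONEST FRAMING (cell contract, verbatim): «discharging `BetaPertH` makes Bałaban's UV
stability UNCONDITIONAL — a real constructive-QFT result; it is NOT the continuum limit and NOT the Clay problem.»
NOT IN PRINT; OUR BOOKKEEPING: [folklore] compositions BY NAME of tree theorems about OUR typed objects at weight 0; no `def`, no `def … : Prop`, no cited fact, 0 sorry.

WHY.  After gen 55 the (III′) (C)-row END of record `CombChargeRowsHold.exists_allScalesSeq_JsB12CombShSym_an1` is the HYPOTHESIS-FREE all-scales letter
`∃ κ θ, 0 ≤ θ < 1 ∧ AllScalesSeq β κ θ`, `β_j := secondMoment (TbalOf Lc (JsB12CombShSym hLc N (symTablesAn1S2 3 Lc cΛ) cΛ cB) j) μ ν`, from `Odd Lc`, `2 ≤ Lc`, `2 ≤ N` and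
the two unit locks `cΛ·Lc⁴ = 2`, `cB = −Lc¹²∕4` ONLY.  The rows this row gates read such a letter in their OWN shapes — lane asym1's `Beta.Assembly.LimitForm` wants the
field `conv : ∀ k, |S.β0 k − binf| ≤ c₀·θ^k` (= `RateCertificate.GeomRate S.β0 binf c₀ θ`) with `0 ≤ c₀`, `0 ≤ θ < 1`; road A2's wall socket is `D1Drift ↔ β_j → stepBal`;
road «FP»'s route theorem `FixedPointIdentification.oneLoopDrift_stepBal_of_rate_step_law_*` wants `hrate : GeomRate β (f Lc) c₀ θ`; road «BF-x» reads Cesàro means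
(`D1BFx.RoadEnd`); the END grade is `OneStepKernelFamily.endpointExistence_of_D1Drift`.  At (E) these plugs are `RowD1LiteralOfTowerEnd` §2 ∕ `TowerEndRowD1Sockets`; this file is
their (III′) twin, token for token, with the END of record as the ONE supplier.  After it, NO consumer of the (III′) END displays a row-G-an2-4 binder of any shape.

CONTENT (`d + 1 = 4`; `Lc` odd, `2 ≤ Lc`, `2 ≤ N`, the two locks; every channel `(μ, ν)`; the colour parameter `Nc : ℝ` of `D1Drift` FREE, as in every D1-side END of record):
* §1 the letter in four currencies: `tendsto_secondMoment_JsB12CombShSym_an1` (`β_j → CauchyRate.lim β`), `exists_geomRate_secondMoment_JsB12CombShSym_an1`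
  (`∃ κ θ, 0 ≤ κ ∧ 0 ≤ θ < 1 ∧ GeomRate β (lim β) κ θ` — lane asym1's `conv ∕ c₀_nonneg ∕ θ_nonneg ∕ θ_lt_one` for THIS chart), `exists_geomRate_of_tendsto` (the same about ANY
  limit value `a` given `β_j → a` — road FP's `hrate`), `exists_oneLoopDrift_lim` (`∃ A, OneLoopDrift (lim β) A β`: the coefficients DO drift, with slope their limit — so
  `D1Drift` for the literal of record is EXACTLY a value statement), `exists_conv_of_dictionary` (asym1's four `LimitForm` rate fields for ANY one-loop split `Sβ` under an2's
  dictionary `hβ : Sβ.β0 j = β_j`; `binf_pos` is the VALUE's sign and stays row D1's).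
* §2 road A2's socket, letter-free: `d1Drift_JsB12CombShSym_an1_iff_tendsto_stepBal` (`D1Drift ↔ β_j → stepBal Nc Lc`), `d1Drift_JsB12CombShSym_an1_iff_cesaro` (`↔` Cesàro means `→ stepBal Nc Lc`).
* §3 road «FP», RATE-FREE: `d1Drift_JsB12CombShSym_an1_of_step_law_bounded ∕ _littleO` (dictionary clause `β_j → f Lc` + step law of `f` + leading-log asymptotics ⟹ `D1Drift`).
* §4 road «BF-x», MEAN grading, slot-free: `d1Drift_JsB12CombShSym_an1_of_meanRoad` ((B1_mean) ∧ (T_mean) ⟹ `D1Drift`).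
* §5 END grade: `endpointExistence_of_lim_eq_comb_an1` ∕ `endpointExistence_of_tendsto_stepBal_comb_an1` (the scalar identification + `hβ` + (D4) + (C) ⟹ `EndpointExistence`).
WHAT IT IS NOT.  It asserts NO value of Bałaban's tables; it does NOT prove `lim β = stepBal Nc Lc`, `β_j → stepBal Nc Lc`, `0 < lim β`, the step law, (B1_mean)∕(T_mean), `D1Rep`, (D4) or (C)
— those are row D1's ∕ an4's ∕ the roads' displayed clauses; `JsB12CombShSym …` is OUR typed comb chart of record (U = 1 constituent, an1's sym tables), its identification with Bałaban's
`G_k ∕ H_k ∕ C^{(k)}` data is an2's; «G-an2-4 closed» as (CONV-C) is the binder's call on its own line, NOT this file's; NOT asym, NOT D1, NOT `BetaPertH`, NOT continuum, NOT Clay.  2026-08-28.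
-/

noncomputable section

open Finset Filter Topology
open scoped BigOperators
open Literature.MathematicalPhysics.QuantumFieldTheory
open Literature.MathematicalPhysics.QuantumFieldTheory.Balaban1983to89
open Literature.MathematicalPhysics.QuantumFieldTheory.Balaban1983to89.Beta
open FlowStep (HBeta BetaContH)
open DagBinding (EndpointExistence ForwardGenerated)
open RemainderConstAllScales (AllScalesSeq)
open RateCertificate (GeomRate CauchyRate)
open Drift (OneLoopDrift)
open B12Beta (secondMoment)
open B12Normalization (stepBal)
open OneStepKernelFamily (TbalOf D1Drift endpointExistence_of_D1Drift)
open Literature.MathematicalPhysics.QuantumFieldTheory.Balaban1983to89.Beta.RemainderChain (RemainderConst)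
open Summit.QuantumFields.BalabanUV.Beta.SymSecondOrderTablesAn1 (symTablesAn1S2)
open Summit.QuantumFields.BalabanUV.Beta.CombChartJointEnd (JsB12CombShSym)
open Summit.QuantumFields.BalabanUV.Beta.GAN24.CombChargeRowsHold (exists_allScalesSeq_JsB12CombShSym_an1 d1Drift_JsB12CombShSym_an1_iff_lim_eq)
open Summit.QuantumFields.BalabanUV.Beta.D1BFx.RoadEnd (d1Drift_iff_cesaro d1Drift_of_meanRoad)
open Summit.QuantumFields.BalabanUV.Beta.FixedPointIdentification (oneLoopDrift_stepBal_of_rate_step_law_bounded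
  oneLoopDrift_stepBal_of_rate_step_law_littleO)

namespace Summit.QuantumFields.BalabanUV.Beta.GAN24.CombTowerEndRowD1Sockets

variable {Lc : ℕ} [NeZero Lc]

/-! ## §1 The END of record in four currencies: convergence, two-ended geometric rate, drift about the limit, asym1's `conv` fields -/

/-- NOT IN PRINT; OUR BOOKKEEPING.  **THE STEP COEFFICIENTS OF THE COMB CHART OF RECORD CONVERGE** to the constructed limit `CauchyRate.lim β`
(`AllScalesSeq.tendsto_lim` at the END `CombChargeRowsHold.exists_allScalesSeq_JsB12CombShSym_an1`). -/
theorem tendsto_secondMoment_JsB12CombShSym_an1 (hLc : Odd Lc) (hL2 : 2 ≤ Lc) {N : ℕ} (hN : 2 ≤ N) {cΛ cB : ℝ} (hΛ : cΛ * (Lc : ℝ) ^ 4 = 2)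
    (hcB : cB = -((Lc : ℝ) ^ 12 / 4)) (μ ν : Fin 4) :
    Tendsto (fun j => secondMoment (TbalOf Lc (JsB12CombShSym hLc N (symTablesAn1S2 3 Lc cΛ) cΛ cB) j) μ ν) atTop
      (𝓝 (CauchyRate.lim fun j => secondMoment (TbalOf Lc (JsB12CombShSym hLc N (symTablesAn1S2 3 Lc cΛ) cΛ cB) j) μ ν)) := by
  obtain ⟨κ, θ, -, hθ1, hall⟩ := exists_allScalesSeq_JsB12CombShSym_an1 hLc hL2 hN hΛ hcB μ ν
  exact hall.tendsto_lim hθ1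

/-- NOT IN PRINT; OUR BOOKKEEPING.  **… WITH A TWO-ENDED GEOMETRIC RATE ABOUT THE LIMIT, CONSTANTS SIGNED**: `∃ κ θ, 0 ≤ κ ∧ 0 ≤ θ ∧ θ < 1 ∧ GeomRate β (lim β) κ θ`,
i.e. `|β_k − lim β| ≤ κ·θ^k` for every `k` — lane asym1's `LimitForm` fields `conv ∕ c₀_nonneg ∕ θ_nonneg ∕ θ_lt_one` for THIS chart of record (`binf := lim β`; the field
`binf_pos` is the VALUE's sign, row D1's).  `AllScalesSeq.geomRate` + `AllScalesSeq.const_nonneg` at the END, same `κ`, same `θ`. -/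
theorem exists_geomRate_secondMoment_JsB12CombShSym_an1 (hLc : Odd Lc) (hL2 : 2 ≤ Lc) {N : ℕ} (hN : 2 ≤ N) {cΛ cB : ℝ} (hΛ : cΛ * (Lc : ℝ) ^ 4 = 2)
    (hcB : cB = -((Lc : ℝ) ^ 12 / 4)) (μ ν : Fin 4) :
    ∃ κ θ : ℝ, 0 ≤ κ ∧ 0 ≤ θ ∧ θ < 1 ∧
      GeomRate (fun j => secondMoment (TbalOf Lc (JsB12CombShSym hLc N (symTablesAn1S2 3 Lc cΛ) cΛ cB) j) μ ν)
        (CauchyRate.lim fun j => secondMoment (TbalOf Lc (JsB12CombShSym hLc N (symTablesAn1S2 3 Lc cΛ) cΛ cB) j) μ ν) κ θ := by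
  obtain ⟨κ, θ, hθ0, hθ1, hall⟩ := exists_allScalesSeq_JsB12CombShSym_an1 hLc hL2 hN hΛ hcB μ ν
  exact ⟨κ, θ, hall.const_nonneg, hθ0, hθ1, hall.geomRate hθ1⟩

/-- NOT IN PRINT; OUR BOOKKEEPING.  **TWO-ENDED GEOMETRIC RATE ABOUT ANY LIMIT VALUE**: if `β_j → a` then `∃ κ θ, 0 ≤ κ ∧ 0 ≤ θ < 1 ∧ GeomRate β a κ θ`
(`AllScalesSeq.geomRate_of_tendsto`) — road «FP»'s `hrate` binder for the literal of record GIVEN only the dictionary clause `β_j → a` (row D1's). -/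
theorem exists_geomRate_of_tendsto (hLc : Odd Lc) (hL2 : 2 ≤ Lc) {N : ℕ} (hN : 2 ≤ N) {cΛ cB : ℝ} (hΛ : cΛ * (Lc : ℝ) ^ 4 = 2)
    (hcB : cB = -((Lc : ℝ) ^ 12 / 4)) (μ ν : Fin 4) {a : ℝ}
    (ha : Tendsto (fun j => secondMoment (TbalOf Lc (JsB12CombShSym hLc N (symTablesAn1S2 3 Lc cΛ) cΛ cB) j) μ ν) atTop (𝓝 a)) :
    ∃ κ θ : ℝ, 0 ≤ κ ∧ 0 ≤ θ ∧ θ < 1 ∧ GeomRate (fun j => secondMoment (TbalOf Lc (JsB12CombShSym hLc N (symTablesAn1S2 3 Lc cΛ) cΛ cB) j) μ ν) a κ θ := by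
  obtain ⟨κ, θ, hθ0, hθ1, hall⟩ := exists_allScalesSeq_JsB12CombShSym_an1 hLc hL2 hN hΛ hcB μ ν
  exact ⟨κ, θ, hall.const_nonneg, hθ0, hθ1, hall.geomRate_of_tendsto ha⟩

/-- NOT IN PRINT; OUR BOOKKEEPING.  **THE COEFFICIENTS OF THE LITERAL OF RECORD DRIFT WITH SLOPE THEIR LIMIT**: `∃ A, OneLoopDrift (CauchyRate.lim β) A β`
(`HessKerDressedCauchy.oneLoopDrift_lim` at the END, `A = κ∕(1−θ)`) — so `D1Drift` for the literal of record is EXACTLY the value statement `lim β = stepBal Nc Lc`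
(`CombChargeRowsHold.d1Drift_JsB12CombShSym_an1_iff_lim_eq`; convergence form §2 below). -/
theorem exists_oneLoopDrift_lim (hLc : Odd Lc) (hL2 : 2 ≤ Lc) {N : ℕ} (hN : 2 ≤ N) {cΛ cB : ℝ} (hΛ : cΛ * (Lc : ℝ) ^ 4 = 2)
    (hcB : cB = -((Lc : ℝ) ^ 12 / 4)) (μ ν : Fin 4) :
    ∃ A : ℝ, OneLoopDrift (CauchyRate.lim fun j => secondMoment (TbalOf Lc (JsB12CombShSym hLc N (symTablesAn1S2 3 Lc cΛ) cΛ cB) j) μ ν) A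
      (fun j => secondMoment (TbalOf Lc (JsB12CombShSym hLc N (symTablesAn1S2 3 Lc cΛ) cΛ cB) j) μ ν) := by
  obtain ⟨κ, θ, hθ0, hθ1, hall⟩ := exists_allScalesSeq_JsB12CombShSym_an1 hLc hL2 hN hΛ hcB μ ν
  exact ⟨_, HessKerDressedCauchy.oneLoopDrift_lim hall hθ0 hθ1⟩

/-- NOT IN PRINT; OUR BOOKKEEPING.  **LANE asym1's RATE FIELDS FOR ANY ONE-LOOP SPLIT IDENTIFIED WITH THE COMB CHART OF RECORD**: under an2's dictionary
`hβ : ∀ j, Sβ.β0 j = β_j` the four `LimitForm` fields `(binf, c₀, θ, conv)` with `0 ≤ c₀`, `0 ≤ θ < 1`, `conv : ∀ k, |Sβ.β0 k − binf| ≤ c₀·θ^k` are inhabited, `binf := lim β`.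
The dictionary `hβ` (an2's identification of a record's one-loop numbers with OUR typed second moments) and `binf_pos` (the VALUE's sign) are NOT proved here. -/
theorem exists_conv_of_dictionary (hLc : Odd Lc) (hL2 : 2 ≤ Lc) {N : ℕ} (hN : 2 ≤ N) {cΛ cB : ℝ} (hΛ : cΛ * (Lc : ℝ) ^ 4 = 2)
    (hcB : cB = -((Lc : ℝ) ^ 12 / 4)) {μ ν : Fin 4} {β : HBeta} (Sβ : B12Beta.OneLoopSplit β)
    (hβ : ∀ j, Sβ.β0 j = secondMoment (TbalOf Lc (JsB12CombShSym hLc N (symTablesAn1S2 3 Lc cΛ) cΛ cB) j) μ ν) :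
    ∃ binf c₀ θ : ℝ, 0 ≤ c₀ ∧ 0 ≤ θ ∧ θ < 1 ∧ (∀ k, |Sβ.β0 k - binf| ≤ c₀ * θ ^ k) ∧
      binf = CauchyRate.lim (fun j => secondMoment (TbalOf Lc (JsB12CombShSym hLc N (symTablesAn1S2 3 Lc cΛ) cΛ cB) j) μ ν) := by
  obtain ⟨κ, θ, hκ, hθ0, hθ1, hrate⟩ := exists_geomRate_secondMoment_JsB12CombShSym_an1 hLc hL2 hN hΛ hcB μ ν
  exact ⟨_, κ, θ, hκ, hθ0, hθ1, fun k => by rw [hβ k]; exact hrate k, rfl⟩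

/-! ## §2 Road A2's wall socket for the literal of record in CONVERGENCE ∕ CESÀRO form, letter-free -/

/-- NOT IN PRINT; OUR BOOKKEEPING.  **THE WALL ⟺ CONVERGENCE OF THE COEFFICIENTS TO `stepBal Nc Lc`, LETTER-FREE**: for odd `Lc ≥ 2`, `N ≥ 2`, the two locks, every channel and
every colour parameter `Nc`: `D1Drift Lc (JsB12CombShSym …) Nc μ ν ↔ β_j → stepBal Nc Lc` (the END's `d1Drift_JsB12CombShSym_an1_iff_lim_eq` + `tendsto_secondMoment_JsB12CombShSym_an1` BY
NAME + uniqueness of limits).  The right side is row D1's and is NOT proved. -/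
theorem d1Drift_JsB12CombShSym_an1_iff_tendsto_stepBal (hLc : Odd Lc) (hL2 : 2 ≤ Lc) {N : ℕ} (hN : 2 ≤ N) {cΛ cB : ℝ} (hΛ : cΛ * (Lc : ℝ) ^ 4 = 2)
    (hcB : cB = -((Lc : ℝ) ^ 12 / 4)) (μ ν : Fin 4) (Nc : ℝ) :
    D1Drift Lc (JsB12CombShSym hLc N (symTablesAn1S2 3 Lc cΛ) cΛ cB) Nc μ ν ↔
      Tendsto (fun j => secondMoment (TbalOf Lc (JsB12CombShSym hLc N (symTablesAn1S2 3 Lc cΛ) cΛ cB) j) μ ν) atTop (𝓝 (stepBal Nc Lc)) := by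
  rw [d1Drift_JsB12CombShSym_an1_iff_lim_eq hLc hL2 hN hΛ hcB μ ν Nc]
  exact ⟨fun h => h ▸ tendsto_secondMoment_JsB12CombShSym_an1 hLc hL2 hN hΛ hcB μ ν,
    fun h => tendsto_nhds_unique (tendsto_secondMoment_JsB12CombShSym_an1 hLc hL2 hN hΛ hcB μ ν) h⟩

/-- NOT IN PRINT; OUR BOOKKEEPING.  **THE WALL ⟺ THE CESÀRO MEANS OF THE COEFFICIENTS TEND TO `stepBal Nc Lc`** (`D1BFx.RoadEnd.d1Drift_iff_cesaro` at the END) — what road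
«BF-x»'s MEAN grading decides for the literal of record.  The right side is NOT proved. -/
theorem d1Drift_JsB12CombShSym_an1_iff_cesaro (hLc : Odd Lc) (hL2 : 2 ≤ Lc) {N : ℕ} (hN : 2 ≤ N) {cΛ cB : ℝ} (hΛ : cΛ * (Lc : ℝ) ^ 4 = 2)
    (hcB : cB = -((Lc : ℝ) ^ 12 / 4)) (μ ν : Fin 4) (Nc : ℝ) :
    D1Drift Lc (JsB12CombShSym hLc N (symTablesAn1S2 3 Lc cΛ) cΛ cB) Nc μ ν ↔
      Tendsto (fun m : ℕ => (∑ j ∈ range m, secondMoment (TbalOf Lc (JsB12CombShSym hLc N (symTablesAn1S2 3 Lc cΛ) cΛ cB) j) μ ν) / (m : ℝ)) atTop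
        (𝓝 (stepBal Nc Lc)) := by
  obtain ⟨κ, θ, hθ0, hθ1, hall⟩ := exists_allScalesSeq_JsB12CombShSym_an1 hLc hL2 hN hΛ hcB μ ν
  exact d1Drift_iff_cesaro _ hall hθ0 hθ1 Nc

/-! ## §3 Road «FP»'s route theorem for the literal of record, RATE-FREE -/

/-- NOT IN PRINT; OUR BOOKKEEPING.  **ROAD «FP» FOR THE LITERAL OF RECORD, `hrate` DISCHARGED (bounded-defect form)**: IF the coefficients converge to the `Lc`-member
`f Lc` of a family `f` (the DICTIONARY clause — NOT proved here), AND `f` obeys the step law on the powers of `Lc`, AND `|f (Lc^m) − stepBal Nc (Lc^m)| ≤ C` for `m ≥ 1`, THEN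
`D1Drift Lc (JsB12CombShSym …) Nc μ ν` — `FixedPointIdentification.oneLoopDrift_stepBal_of_rate_step_law_bounded` with `hrate ⟸` the END (`AllScalesSeq.geomRate_of_tendsto`).
The three displayed clauses are row D1's; only row G-an2-4's rate binder is discharged. -/
theorem d1Drift_JsB12CombShSym_an1_of_step_law_bounded (hLc : Odd Lc) (hL2 : 2 ≤ Lc) {N : ℕ} (hN : 2 ≤ N) {cΛ cB : ℝ} (hΛ : cΛ * (Lc : ℝ) ^ 4 = 2)
    (hcB : cB = -((Lc : ℝ) ^ 12 / 4)) {μ ν : Fin 4} {Nc : ℝ} {f : ℕ → ℝ} {C : ℝ}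
    (hlim : Tendsto (fun j => secondMoment (TbalOf Lc (JsB12CombShSym hLc N (symTablesAn1S2 3 Lc cΛ) cΛ cB) j) μ ν) atTop (𝓝 (f Lc)))
    (hstep : ∀ m : ℕ, 1 ≤ m → f (Lc ^ (m + 1)) = f (Lc ^ m) + f Lc)
    (hasym : ∀ m : ℕ, 1 ≤ m → |f (Lc ^ m) - stepBal Nc ((Lc : ℝ) ^ m)| ≤ C) :
    D1Drift Lc (JsB12CombShSym hLc N (symTablesAn1S2 3 Lc cΛ) cΛ cB) Nc μ ν := by
  obtain ⟨κ, θ, hθ0, hθ1, hall⟩ := exists_allScalesSeq_JsB12CombShSym_an1 hLc hL2 hN hΛ hcB μ ν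
  exact ⟨_, oneLoopDrift_stepBal_of_rate_step_law_bounded (hall.geomRate_of_tendsto hlim) hθ0 hθ1 hstep hasym⟩

/-- NOT IN PRINT; OUR BOOKKEEPING.  **ROAD «FP» FOR THE LITERAL OF RECORD, `hrate` DISCHARGED (mean-law form)**: as above with the asymptotic input weakened to `o(m)`. -/
theorem d1Drift_JsB12CombShSym_an1_of_step_law_littleO (hLc : Odd Lc) (hL2 : 2 ≤ Lc) {N : ℕ} (hN : 2 ≤ N) {cΛ cB : ℝ} (hΛ : cΛ * (Lc : ℝ) ^ 4 = 2)
    (hcB : cB = -((Lc : ℝ) ^ 12 / 4)) {μ ν : Fin 4} {Nc : ℝ} {f : ℕ → ℝ}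
    (hlim : Tendsto (fun j => secondMoment (TbalOf Lc (JsB12CombShSym hLc N (symTablesAn1S2 3 Lc cΛ) cΛ cB) j) μ ν) atTop (𝓝 (f Lc)))
    (hstep : ∀ m : ℕ, 1 ≤ m → f (Lc ^ (m + 1)) = f (Lc ^ m) + f Lc)
    (hasym : Tendsto (fun m : ℕ => (f (Lc ^ m) - stepBal Nc ((Lc : ℝ) ^ m)) / (m : ℝ)) atTop (𝓝 0)) :
    D1Drift Lc (JsB12CombShSym hLc N (symTablesAn1S2 3 Lc cΛ) cΛ cB) Nc μ ν := by
  obtain ⟨κ, θ, hθ0, hθ1, hall⟩ := exists_allScalesSeq_JsB12CombShSym_an1 hLc hL2 hN hΛ hcB μ ν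
  exact ⟨_, oneLoopDrift_stepBal_of_rate_step_law_littleO (hall.geomRate_of_tendsto hlim) hθ0 hθ1 hstep hasym⟩

/-! ## §4 Road «BF-x»'s MEAN grading for the literal of record, slot-free -/

/-- NOT IN PRINT; OUR BOOKKEEPING.  **THE MEAN ROAD END FOR THE LITERAL OF RECORD, SLOT-FREE**: (B1_mean) a Cesàro-null telescoping defect of the step coefficients
against a one-shot coefficient `c (Lc^m)` (free function) ∧ (T_mean) `c (Lc^m)∕m → stepBal Nc Lc` ⟹ `D1Drift Lc (JsB12CombShSym …) Nc μ ν` (`D1BFx.RoadEnd.d1Drift_of_meanRoad` at the END).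
(B1_mean) and (T_mean) are road «BF-x»'s displayed debt — HYPOTHESES, not row G-an2-4's. -/
theorem d1Drift_JsB12CombShSym_an1_of_meanRoad (hLc : Odd Lc) (hL2 : 2 ≤ Lc) {N : ℕ} (hN : 2 ≤ N) {cΛ cB : ℝ} (hΛ : cΛ * (Lc : ℝ) ^ 4 = 2)
    (hcB : cB = -((Lc : ℝ) ^ 12 / 4)) {μ ν : Fin 4} (Nc : ℝ) (c : ℕ → ℝ)
    (hB1 : Tendsto (fun m : ℕ => ((∑ j ∈ range m, secondMoment (TbalOf Lc (JsB12CombShSym hLc N (symTablesAn1S2 3 Lc cΛ) cΛ cB) j) μ ν) - c (Lc ^ m)) / (m : ℝ))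
      atTop (𝓝 0))
    (hT : Tendsto (fun m : ℕ => c (Lc ^ m) / (m : ℝ)) atTop (𝓝 (stepBal Nc Lc))) :
    D1Drift Lc (JsB12CombShSym hLc N (symTablesAn1S2 3 Lc cΛ) cΛ cB) Nc μ ν := by
  obtain ⟨κ, θ, hθ0, hθ1, hall⟩ := exists_allScalesSeq_JsB12CombShSym_an1 hLc hL2 hN hΛ hcB μ ν
  exact d1Drift_of_meanRoad _ hall hθ0 hθ1 Nc c hB1 hT

/-! ## §5 END grade: the scalar identification + `hβ` + (D4) + (C) ⟹ `EndpointExistence` -/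

/-- NOT IN PRINT; OUR BOOKKEEPING.  **THE END FROM THE SCALAR IDENTIFICATION**: IF `CauchyRate.lim β = stepBal Nc Lc` (row D1's identification for the literal of record — NOT
proved), `Sβ.β0 j = β_j` (an2's dictionary `hβ`), the remainder constant (D4) with `rr ≤ stepBal Nc Lc`, and continuity (C), THEN `EndpointExistence Cn`
(`OneStepKernelFamily.endpointExistence_of_D1Drift` ⨾ the END's `d1Drift_JsB12CombShSym_an1_iff_lim_eq` BY NAME).  Four displayed binders, none of row G-an2-4's. -/
theorem endpointExistence_of_lim_eq_comb_an1 (hLc : Odd Lc) (hL2 : 2 ≤ Lc) {N : ℕ} (hN : 2 ≤ N) {cΛ cB : ℝ} (hΛ : cΛ * (Lc : ℝ) ^ 4 = 2)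
    (hcB : cB = -((Lc : ℝ) ^ 12 / 4)) {μ ν : Fin 4} {Nc : ℝ}
    (hI : CauchyRate.lim (fun j => secondMoment (TbalOf Lc (JsB12CombShSym hLc N (symTablesAn1S2 3 Lc cΛ) cΛ cB) j) μ ν) = stepBal Nc Lc)
    {β : HBeta} {Cn : B12.Construction} (hgen : ForwardGenerated Cn β) (Sβ : B12Beta.OneLoopSplit β)
    (hβ : ∀ j, Sβ.β0 j = secondMoment (TbalOf Lc (JsB12CombShSym hLc N (symTablesAn1S2 3 Lc cΛ) cΛ cB) j) μ ν)
    {rr γ₀ : ℝ} (hγ₀ : 0 < γ₀) (hrem : RemainderConst Sβ γ₀ rr) (hr : rr ≤ stepBal Nc Lc) (hcont : BetaContH γ₀ β) :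
    EndpointExistence Cn :=
  endpointExistence_of_D1Drift hgen Sβ (JsB12CombShSym hLc N (symTablesAn1S2 3 Lc cΛ) cΛ cB) hβ
    ((d1Drift_JsB12CombShSym_an1_iff_lim_eq hLc hL2 hN hΛ hcB μ ν Nc).2 hI) hγ₀ hrem hr hcont

/-- NOT IN PRINT; OUR BOOKKEEPING.  **THE END FROM CONVERGENCE TO `stepBal Nc Lc`** — the same with the identification in road A2's convergence form
(`β_j → stepBal Nc Lc`, NOT proved) through §2. -/
theorem endpointExistence_of_tendsto_stepBal_comb_an1 (hLc : Odd Lc) (hL2 : 2 ≤ Lc) {N : ℕ} (hN : 2 ≤ N) {cΛ cB : ℝ} (hΛ : cΛ * (Lc : ℝ) ^ 4 = 2)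
    (hcB : cB = -((Lc : ℝ) ^ 12 / 4)) {μ ν : Fin 4} {Nc : ℝ}
    (hT : Tendsto (fun j => secondMoment (TbalOf Lc (JsB12CombShSym hLc N (symTablesAn1S2 3 Lc cΛ) cΛ cB) j) μ ν) atTop (𝓝 (stepBal Nc Lc)))
    {β : HBeta} {Cn : B12.Construction} (hgen : ForwardGenerated Cn β) (Sβ : B12Beta.OneLoopSplit β)
    (hβ : ∀ j, Sβ.β0 j = secondMoment (TbalOf Lc (JsB12CombShSym hLc N (symTablesAn1S2 3 Lc cΛ) cΛ cB) j) μ ν)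
    {rr γ₀ : ℝ} (hγ₀ : 0 < γ₀) (hrem : RemainderConst Sβ γ₀ rr) (hr : rr ≤ stepBal Nc Lc) (hcont : BetaContH γ₀ β) :
    EndpointExistence Cn :=
  endpointExistence_of_D1Drift hgen Sβ (JsB12CombShSym hLc N (symTablesAn1S2 3 Lc cΛ) cΛ cB) hβ
    ((d1Drift_JsB12CombShSym_an1_iff_tendsto_stepBal hLc hL2 hN hΛ hcB μ ν Nc).2 hT) hγ₀ hrem hr hcont

end Summit.QuantumFields.BalabanUV.Beta.GAN24.CombTowerEndRowD1Sockets

end
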